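import Summits.QuantumFields.YangMills.Theorems.SmallFieldWideningLargeFieldMassRefinementTailPlainStab

/-!
# Route `SmallFieldWidening`, crux r3 `LargeFieldMassRefinementTail` (stmt-QuantumFields-22884) — LINE «additive unit-stability ladder»
# (planner `ym-idea-1` g6, technique «restrict-then-tighten»; rung R3 `YM3TorusSU2` is a RECORD rung — no summit is proved by any line)

WHAT THIS IS NOT.  No estimate of Bałaban's programme is proved; nothing bears on the Yang–Mills mass gap.

THE LINE.  The width seat `ym-line-sfw-p2-w2` reduced the shared stub / crux r3 to the ONE-STEP, ONE-SIDED, PURELY MULTIPLICATIVE UV-stability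
`PlainStab` of the unconditioned unit-plaquette tail (`…PlainStab.unitTop_of_plainStab`): `c_{K+1}(q) ≤ e^{ρ_K} c_K(q)`, `Σ ρ` sub-Gaussian.
A purely multiplicative comparison must price the genuinely NEW large-field events of run `K+1` (a large plaquette of the new, finest
fluctuation field above `q`) in units of `c_K(q)` — which is itself super-polynomially small — so `PlainStab` as typed asks the new level to be
large-field-free at relative precision `e^{ρ_K}`.  RESTRICT-THEN-TIGHTEN splits the step: the multiplicative comparison is asked only up to an
ADDITIVE slack `τ_K ≥ 0` (the new level's own large-field mass near `q`, which in `d = 3` is `≲ L^{3(K+1)}·e^{−c p(g_{K+1})²}` with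
`g_{K+1}² = γ L^{−(K+1)}` — summable in `K`, uniformly in the volume, by the tree's `FirstExitDeepBoundedHeight.perPlaquette_boundedHeight_uniform 0`),
and the multiplicative slack is controlled on every INTERVAL of levels (one-sided stability from any run to any later run):

`PlainStabAdd` (route item, text of §1's hypothesis): the prover chooses a STARTING RUN `k₀ ≥ 1`, his own BASE tail at run `k₀`
(`c_{k₀} ≤ C_b γ^{−N_b} e^{−c_b p(√γ)²}` — for any fixed `k₀` a tree theorem, `perPlaquette_boundedHeight_uniform k₀`), THRESHOLD MULTIPLIERS
`t_K ∈ [1/2, 1]` (absorbing the cut-off drift of the quadratic part of the unit-plaquette rate function — the Gaussian lattice artefact of unknown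
sign that forced the sibling route `LevelShiftBootstrap` to its v4), and slacks with `η < min(c_b, c_τ)` FIXED (not `∀ η`):
`c_{K+1}(q; t_{K+1}θ) ≤ e^{ρ_K}·c_K(q; t_Kθ) + τ_K` (`K ≥ k₀`),  `Σ_{k≤j<K} ρ_j ≤ A + η·p(√γ)²` (`k ≥ k₀`),  `Σ_{k₀≤k<K} τ_k ≤ C_τ γ^{−N_τ} e^{−c_τ p(√γ)²}`.

THEN (§0, a discrete Grönwall chain `chain_add_le`; §1) the window-free height-free unit-top tail `UnitTop` holds with constants uniform in the
family (runs `K ≤ k₀` by the tree's bounded-height theorem, runs `K ≥ k₀` by the chain and `{θ ≤ |·|} ⊆ {t_Kθ ≤ |·|}`), hence (§2, the landed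
normal form `…UnitTop`) crux r3 `LargeFieldMassRefinementTail` (stmt-QuantumFields-22884), `FirstExitWindowTailL` (stmt-QuantumFields-26243) and
`HistoryTailL` (stmt-QuantumFields-19936) BY NAME.  The width seats' `PlainStab` with interval control of `ρ` implies it (`τ ≡ 0`, `t ≡ 1`, `k₀ = 1`; §2).

References: T. Bałaban, Commun. Math. Phys. **102** (1985) 255–275 [Balaban1985UV3] ((7) p.257, (70)–(71) p.273); CMP **109** (1987) 249–301
[Balaban1987RG1] (Thm 1 p.259); CMP **122** (1989) 355–392 [Balaban1989LargeFieldII] (§1, the R-operation); C. King, CMP **102** (1986) 649–677 [King1986] (Thm 3.4).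
-/

noncomputable section

open MeasureTheory Filter Topology
open scoped BigOperators
open Literature.MathematicalPhysics.QuantumFieldTheory.Balaban1983to89
open Literature.MathematicalPhysics.QuantumFieldTheory.Balaban1983to89.Missing
open Literature.MathematicalPhysics.QuantumFieldTheory.Balaban1983to89.T3ContinuumYM3Torus
open Literature.MathematicalPhysics.QuantumFieldTheory.Balaban1983to89.T3UnitScaleTilt
open Literature.MathematicalPhysics.QuantumFieldTheory.Balaban1983to89.T3UnitLawDensityEML (ℰp)
open Literature.MathematicalPhysics.QuantumFieldTheory.Balaban1983to89.T3LevelShift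
open Summit.QuantumFields.YangMills.Theorems.FirstExitDeepBoundedHeight (perPlaquette_boundedHeight_uniform)
open Summit.QuantumFields.YangMills.Theorems.LargeFieldMassRefinementTailUnitTop
  (firstExitWindowTailL_of_unitTop largeFieldMassRefinementTail_of_unitTop historyTailL_of_unitTop)

namespace Summit.QuantumFields.YangMills.Theorems.LargeFieldMassRefinementTailPlainStabAdd

/-! ## §0 The discrete Grönwall chain from a starting index `k₀` -/

/-- Exact chaining of `c_{K+1} ≤ e^{ρ_K} c_K + τ_K` from `K = k₀`. [folklore] -/
theorem chain_add_aux {c ρ τ : ℕ → ℝ} {k₀ : ℕ}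
    (h : ∀ K, k₀ ≤ K → c (K + 1) ≤ Real.exp (ρ K) * c K + τ K) :
    ∀ K, k₀ ≤ K → c K ≤ Real.exp (∑ j ∈ Finset.Ico k₀ K, ρ j) * c k₀ +
      ∑ k ∈ Finset.Ico k₀ K, Real.exp (∑ j ∈ Finset.Ico (k + 1) K, ρ j) * τ k := by
  intro K hK
  induction K, hK using Nat.le_induction with
  | base => simp
  | succ K hK ih =>
    have hexp : 0 ≤ Real.exp (ρ K) := Real.exp_nonneg _
    have h1 : Real.exp (ρ K) * c K ≤ Real.exp (ρ K) * (Real.exp (∑ j ∈ Finset.Ico k₀ K, ρ j) * c k₀ +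
        ∑ k ∈ Finset.Ico k₀ K, Real.exp (∑ j ∈ Finset.Ico (k + 1) K, ρ j) * τ k) :=
      mul_le_mul_of_nonneg_left ih hexp
    have hEq : Real.exp (ρ K) * (Real.exp (∑ j ∈ Finset.Ico k₀ K, ρ j) * c k₀ +
        ∑ k ∈ Finset.Ico k₀ K, Real.exp (∑ j ∈ Finset.Ico (k + 1) K, ρ j) * τ k) + τ K =
        Real.exp (∑ j ∈ Finset.Ico k₀ (K + 1), ρ j) * c k₀ +
          ∑ k ∈ Finset.Ico k₀ (K + 1), Real.exp (∑ j ∈ Finset.Ico (k + 1) (K + 1), ρ j) * τ k := by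
      rw [Finset.sum_Ico_succ_top hK (fun k => Real.exp (∑ j ∈ Finset.Ico (k + 1) (K + 1), ρ j) * τ k)]
      simp only [Finset.Ico_self, Finset.sum_empty, Real.exp_zero, one_mul]
      rw [Finset.sum_Ico_succ_top hK ρ, Real.exp_add]
      have hinner : ∑ k ∈ Finset.Ico k₀ K, Real.exp (∑ j ∈ Finset.Ico (k + 1) (K + 1), ρ j) * τ k =
          ∑ k ∈ Finset.Ico k₀ K, Real.exp (ρ K) * (Real.exp (∑ j ∈ Finset.Ico (k + 1) K, ρ j) * τ k) := by
        refine Finset.sum_congr rfl fun k hk => ?_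
        have hk' : k + 1 ≤ K := by
          simp only [Finset.mem_Ico] at hk; omega
        rw [Finset.sum_Ico_succ_top hk' ρ, Real.exp_add]; ring
      rw [hinner, ← Finset.mul_sum]; ring
    calc c (K + 1) ≤ Real.exp (ρ K) * c K + τ K := h K hK
      _ ≤ Real.exp (ρ K) * (Real.exp (∑ j ∈ Finset.Ico k₀ K, ρ j) * c k₀ +
          ∑ k ∈ Finset.Ico k₀ K, Real.exp (∑ j ∈ Finset.Ico (k + 1) K, ρ j) * τ k) + τ K := by linarith
      _ = _ := hEq

/-- ★ **Discrete Grönwall**: if every interval sum of `ρ` from `k ≥ k₀` is `≤ B`, `τ ≥ 0` and `c k₀ ≥ 0`, then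
`c_K ≤ e^B (c_{k₀} + Σ_{k₀≤k<K} τ_k)` for `K ≥ k₀`. [folklore] -/
theorem chain_add_le {c ρ τ : ℕ → ℝ} {k₀ : ℕ} {B : ℝ} (hc1 : 0 ≤ c k₀) (hτ : ∀ K, 0 ≤ τ K)
    (hρ : ∀ k K : ℕ, k₀ ≤ k → ∑ j ∈ Finset.Ico k K, ρ j ≤ B)
    (h : ∀ K, k₀ ≤ K → c (K + 1) ≤ Real.exp (ρ K) * c K + τ K) :
    ∀ K, k₀ ≤ K → c K ≤ Real.exp B * (c k₀ + ∑ k ∈ Finset.Ico k₀ K, τ k) := by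
  intro K hK
  refine (chain_add_aux h K hK).trans ?_
  rw [mul_add, Finset.mul_sum]
  gcongr with k hk
  · exact hρ k₀ K le_rfl
  · exact hτ k
  · exact hρ (k + 1) K (by simp only [Finset.mem_Ico] at hk; omega)

/-! ## §1 `UnitTop`, uniformly in the family, from the ADDITIVE one-step stability of the unit-plaquette tail -/

/-- ★★ **THE WINDOW-FREE HEIGHT-FREE UNIT-TOP TAIL (uniform constants) FROM `PlainStabAdd`.**  The hypothesis is the route item `PlainStabAdd`
(stmt-QuantumFields-27684, text verbatim); the conclusion is the right-hand side of `LargeFieldMassRefinementTailUnitTop.deepStub_iff_unitTop`.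
Runs `K ≤ k₀`: the tree's bounded-height theorem `perPlaquette_boundedHeight_uniform k₀`; runs `K ≥ k₀`: the Grönwall chain from the item's own
base, and `{θ ≤ |·|} ⊆ {t_K θ ≤ |·|}` (`t_K ≤ 1`, `θ ≥ 0`). [cite: Balaban1985UV3, (7) p.257 and (70)-(71) p.273; Balaban1987RG1, Thm 1 p.259] -/
theorem unitTop_of_plainStabAdd
    (hPS : ∀ (L : ℕ) (b₀ p₀ : ℝ), 0 < b₀ → 2 < p₀ → ∃ (k₀ Nb Nτ : ℕ) (γ₁ Cb cb Cτ cτ η A : ℝ),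
      1 ≤ k₀ ∧ 0 < γ₁ ∧ γ₁ ≤ 1 ∧ 0 ≤ Cb ∧ 0 ≤ Cτ ∧ 0 ≤ η ∧ η < cb ∧ η < cτ ∧
      ∀ (F : T3Family) (γ : ℝ), F.L = L → 0 < γ → γ ≤ γ₁ → ∀ q : Plaq (F.P 0) 0, ∃ ρ τ t : ℕ → ℝ,
        (∀ K : ℕ, 1 / 2 ≤ t K ∧ t K ≤ 1) ∧
        (gibbsK F ℰp γ k₀).real {U | t k₀ * θBal F.L γ b₀ p₀ 0 ≤ GaugeGroup.dist1 (GaugeField.plaqHol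
            (Averaging.iter (fun i => BlockAveraging.blockAvg (P := F.P k₀) (j := i) ℰp) k₀ U) (plaqShift (F.sitesPerDir_unit k₀) q))} ≤
          Cb * (γ⁻¹) ^ Nb * Real.exp (-(cb * B10.pFun b₀ p₀ (Real.sqrt γ) ^ 2)) ∧
        (∀ k K : ℕ, k₀ ≤ k → ∑ j ∈ Finset.Ico k K, ρ j ≤ A + η * B10.pFun b₀ p₀ (Real.sqrt γ) ^ 2) ∧
        (∀ K : ℕ, 0 ≤ τ K) ∧
        (∀ K : ℕ, ∑ k ∈ Finset.Ico k₀ K, τ k ≤ Cτ * (γ⁻¹) ^ Nτ * Real.exp (-(cτ * B10.pFun b₀ p₀ (Real.sqrt γ) ^ 2))) ∧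
        ∀ K : ℕ, k₀ ≤ K →
          (gibbsK F ℰp γ (K + 1)).real {U | t (K + 1) * θBal F.L γ b₀ p₀ 0 ≤ GaugeGroup.dist1 (GaugeField.plaqHol
            (Averaging.iter (fun i => BlockAveraging.blockAvg (P := F.P (K + 1)) (j := i) ℰp) (K + 1) U) (plaqShift (F.sitesPerDir_unit (K + 1)) q))} ≤
          Real.exp (ρ K) *
          (gibbsK F ℰp γ K).real {U | t K * θBal F.L γ b₀ p₀ 0 ≤ GaugeGroup.dist1 (GaugeField.plaqHol
            (Averaging.iter (fun i => BlockAveraging.blockAvg (P := F.P K) (j := i) ℰp) K U) (plaqShift (F.sitesPerDir_unit K) q))} + τ K) :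
    ∀ (L : ℕ) (b₀ p₀ : ℝ), 0 < b₀ → 2 < p₀ → ∃ (γ₁ C c : ℝ) (N : ℕ), 0 < γ₁ ∧ γ₁ ≤ 1 ∧ 0 < c ∧ 0 ≤ C ∧
      ∀ (F : T3Family) (γ : ℝ), F.L = L → 0 < γ → γ ≤ γ₁ → ∀ (K : ℕ), 2 ≤ K → ∀ p : Plaq (F.P K) K,
        (gibbsK F ℰp γ K).real {U | (∀ k, k < K → PlaqSmall (θBal F.L γ b₀ p₀ (K - k))
            (Averaging.iter (fun i => BlockAveraging.blockAvg (P := F.P K) (j := i) ℰp) k U)) ∧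
          θBal F.L γ b₀ p₀ 0 ≤ GaugeGroup.dist1 (GaugeField.plaqHol
            (Averaging.iter (fun i => BlockAveraging.blockAvg (P := F.P K) (j := i) ℰp) K U) p)} ≤
        C * (γ⁻¹) ^ N * Real.exp (-(c * B10.pFun b₀ p₀ (Real.sqrt γ) ^ 2)) := by
  intro L b₀ p₀ hb₀ hp₀
  obtain ⟨k₀, Nb, Nτ, γs, Cb, cb, Cτ, cτ, η, A, hk₀, hγs, hγs1, hCb, hCτ, hη, hηb, hητ, hslack⟩ := hPS L b₀ p₀ hb₀ hp₀
  -- the volume-uniform bounded-height theorem for the low runs `K ≤ k₀`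
  obtain ⟨γb, C_l, c_l, N_l, hγb, hγb1, hc_l, hC_l, hlow⟩ := perPlaquette_boundedHeight_uniform k₀ L b₀ p₀ hb₀ (by linarith)
  set c₀ : ℝ := min cb cτ with hc₀def
  have hc₀η : η < c₀ := lt_min hηb hητ
  refine ⟨min γb γs, C_l + Real.exp A * (Cb + Cτ), min c_l (c₀ - η), N_l + (Nb + Nτ), lt_min hγb hγs,
    (min_le_left _ _).trans hγb1, lt_min hc_l (sub_pos.mpr hc₀η), by positivity, fun F γ hFL hγ hle K hK p => ?_⟩
  haveI := isProbabilityMeasure_gibbsK F ℰp hγ.le K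
  have hγ1 : γ ≤ 1 := (hle.trans (min_le_left _ _)).trans hγb1
  set P : ℝ := B10.pFun b₀ p₀ (Real.sqrt γ) ^ 2 with hPdef
  have hP : 0 ≤ P := sq_nonneg _
  have hX : 1 ≤ γ⁻¹ := (one_le_inv₀ hγ).mpr hγ1
  have hX0 : 0 ≤ γ⁻¹ := zero_le_one.trans hX
  -- the target bound dominates both partial bounds
  have hdom1 : C_l * (γ⁻¹) ^ N_l * Real.exp (-(c_l * P)) ≤
      (C_l + Real.exp A * (Cb + Cτ)) * (γ⁻¹) ^ (N_l + (Nb + Nτ)) * Real.exp (-(min c_l (c₀ - η) * P)) := by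
    have hA0 : 0 ≤ Real.exp A * (Cb + Cτ) := by positivity
    refine mul_le_mul (mul_le_mul (le_add_of_nonneg_right hA0) (pow_le_pow_right₀ hX (Nat.le_add_right _ _))
      (by positivity) (by positivity)) (Real.exp_le_exp.mpr ?_) (by positivity) (by positivity)
    exact neg_le_neg (mul_le_mul_of_nonneg_right (min_le_left _ _) hP)
  have hdom2 : Real.exp A * (Cb + Cτ) * (γ⁻¹) ^ (Nb + Nτ) * Real.exp (-((c₀ - η) * P)) ≤
      (C_l + Real.exp A * (Cb + Cτ)) * (γ⁻¹) ^ (N_l + (Nb + Nτ)) * Real.exp (-(min c_l (c₀ - η) * P)) := by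
    have hA0 : 0 ≤ Real.exp A * (Cb + Cτ) := by positivity
    refine mul_le_mul (mul_le_mul (le_add_of_nonneg_left hC_l) (pow_le_pow_right₀ hX (Nat.le_add_left _ _))
      (by positivity) (by positivity)) (Real.exp_le_exp.mpr ?_) (by positivity) (by positivity)
    exact neg_le_neg (mul_le_mul_of_nonneg_right (min_le_right _ _) hP)
  -- drop the history clause
  refine (measureReal_mono (fun U hU => hU.2) (measure_ne_top _ _)).trans ?_
  by_cases hKk : K ≤ k₀
  · -- low runs: the bounded-height theorem at height `K ≤ k₀` (`K - K = 0`)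
    have hb := hlow F γ hFL hγ (hle.trans (min_le_left _ _)) K K le_rfl hKk p
    simp only [Nat.sub_self, pow_zero, mul_one] at hb
    exact hb.trans hdom1
  · -- high runs: the chain from the item's base at `k₀`
    have hKk' : k₀ ≤ K := by omega
    set q : Plaq (F.P 0) 0 := (plaqShift (F.sitesPerDir_unit K)).symm p with hq
    obtain ⟨ρ, τ, t, ht, hbase, hρ, hτ0, hτs, hstep⟩ := hslack F γ hFL hγ (hle.trans (min_le_right _ _)) q
    set cc : ℕ → ℝ := fun K' => (gibbsK F ℰp γ K').real {U | t K' * θBal F.L γ b₀ p₀ 0 ≤ GaugeGroup.dist1 (GaugeField.plaqHol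
        (Averaging.iter (fun i => BlockAveraging.blockAvg (P := F.P K') (j := i) ℰp) K' U) (plaqShift (F.sitesPerDir_unit K') q))}
      with hcc
    have hch := chain_add_le (c := cc) (ρ := ρ) (τ := τ) (k₀ := k₀) (B := A + η * P)
      measureReal_nonneg hτ0 hρ (fun K' hK' => by simpa [hcc] using hstep K' hK') K hKk'
    have hpq : plaqShift (F.sitesPerDir_unit K) q = p := (plaqShift (F.sitesPerDir_unit K)).apply_symm_apply p
    -- `{θ ≤ |·|} ⊆ {t_K θ ≤ |·|}`
    have hθ : 0 ≤ θBal F.L γ b₀ p₀ 0 := by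
      unfold θBal
      simp only [pow_zero, mul_one]
      exact mul_nonneg (Real.sqrt_nonneg _) (B10.pFun_nonneg _ _ _ hb₀.le (Real.sqrt_pos.mpr hγ)
        ((Real.sqrt_le_sqrt hγ1).trans (le_of_eq Real.sqrt_one)))
    have hmono : (gibbsK F ℰp γ K).real {U | θBal F.L γ b₀ p₀ 0 ≤ GaugeGroup.dist1 (GaugeField.plaqHol
        (Averaging.iter (fun i => BlockAveraging.blockAvg (P := F.P K) (j := i) ℰp) K U) p)} ≤ cc K := by
      refine measureReal_mono (fun U hU => ?_) (measure_ne_top _ _)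
      simp only [Set.mem_setOf_eq] at hU ⊢
      rw [hpq]
      exact le_trans (mul_le_of_le_one_left hθ (ht K).2) hU
    have hbase' : cc k₀ ≤ Cb * (γ⁻¹) ^ Nb * Real.exp (-(cb * P)) := by simpa [hcc] using hbase
    have hsum : cc k₀ + ∑ k ∈ Finset.Ico k₀ K, τ k ≤ (Cb + Cτ) * (γ⁻¹) ^ (Nb + Nτ) * Real.exp (-(c₀ * P)) := by
      have h1 : Cb * (γ⁻¹) ^ Nb * Real.exp (-(cb * P)) ≤ Cb * (γ⁻¹) ^ (Nb + Nτ) * Real.exp (-(c₀ * P)) := by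
        refine mul_le_mul (mul_le_mul_of_nonneg_left (pow_le_pow_right₀ hX (Nat.le_add_right _ _)) hCb)
          (Real.exp_le_exp.mpr ?_) (by positivity) (by positivity)
        exact neg_le_neg (mul_le_mul_of_nonneg_right (min_le_left _ _) hP)
      have h2 : Cτ * (γ⁻¹) ^ Nτ * Real.exp (-(cτ * P)) ≤ Cτ * (γ⁻¹) ^ (Nb + Nτ) * Real.exp (-(c₀ * P)) := by
        refine mul_le_mul (mul_le_mul_of_nonneg_left (pow_le_pow_right₀ hX (Nat.le_add_left _ _)) hCτ)
          (Real.exp_le_exp.mpr ?_) (by positivity) (by positivity)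
        exact neg_le_neg (mul_le_mul_of_nonneg_right (min_le_right _ _) hP)
      have := add_le_add (hbase'.trans h1) ((hτs K).trans h2)
      linarith
    refine hmono.trans (hch.trans ?_)
    refine (mul_le_mul_of_nonneg_left hsum (Real.exp_nonneg _)).trans (le_trans (le_of_eq ?_) hdom2)
    have hsplit : Real.exp (A + η * P) * Real.exp (-(c₀ * P)) = Real.exp A * Real.exp (-((c₀ - η) * P)) := by
      rw [← Real.exp_add, ← Real.exp_add]; ring_nf
    calc Real.exp (A + η * P) * ((Cb + Cτ) * (γ⁻¹) ^ (Nb + Nτ) * Real.exp (-(c₀ * P)))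
        = (Cb + Cτ) * (γ⁻¹) ^ (Nb + Nτ) * (Real.exp (A + η * P) * Real.exp (-(c₀ * P))) := by ring
      _ = Real.exp A * (Cb + Cτ) * (γ⁻¹) ^ (Nb + Nτ) * Real.exp (-((c₀ - η) * P)) := by rw [hsplit]; ring

/-! ## §2 The route item and the three cruxes by name -/

/-- ★★ **r3 `LargeFieldMassRefinementTail` (stmt-QuantumFields-22884) ⇐ `PlainStabAdd` (stmt-QuantumFields-27684, route item BY NAME).**
Conditional certificate; `PlainStabAdd` is NOT proved; nothing about the mass gap. [cite: Balaban1985UV3, (70)-(71) p.273] -/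
theorem largeFieldMassRefinementTail_of_plainStabAdd
    (h : Summit.QuantumFields.YangMills.Theses.SmallFieldWidening.PlainStabAdd) :
    Summit.QuantumFields.YangMills.Theses.SmallFieldWidening.LargeFieldMassRefinementTail :=
  largeFieldMassRefinementTail_of_unitTop (unitTop_of_plainStabAdd h)

/-- **`FirstExitWindowTailL` (stmt-QuantumFields-26243) ⇐ `PlainStabAdd`.**  Conditional certificate. [cite: Balaban1985UV3, (70)-(71) p.273] -/
theorem firstExitWindowTailL_of_plainStabAdd
    (h : Summit.QuantumFields.YangMills.Theses.SmallFieldWidening.PlainStabAdd) :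
    Summit.QuantumFields.YangMills.Theses.FirstExitWindow.FirstExitWindowTailL :=
  firstExitWindowTailL_of_unitTop (unitTop_of_plainStabAdd h)

/-- **K2′ `HistoryTailL` (stmt-QuantumFields-19936) ⇐ `PlainStabAdd`.**  Conditional certificate. [cite: Balaban1985UV3, (70)-(71) p.273] -/
theorem historyTailL_of_plainStabAdd
    (h : Summit.QuantumFields.YangMills.Theses.SmallFieldWidening.PlainStabAdd) :
    Summit.QuantumFields.YangMills.Theses.UnitScaleTilt.HistoryTailL :=
  historyTailL_of_unitTop (unitTop_of_plainStabAdd h)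

/-- **The width seats' `PlainStab` with INTERVAL control of the slacks implies `PlainStabAdd`** (`k₀ = 1`, `t ≡ 1`, `τ ≡ 0`, base = the tree's
bounded-height theorem at height 1, `η := c_b / 2`).  So the new item is WEAKER than (the interval form of) `PlainStab`. [folklore] -/
theorem plainStabAdd_of_plainStabIntervals
    (hPS : ∀ (L : ℕ) (b₀ p₀ : ℝ), 0 < b₀ → 2 < p₀ → ∃ γ₁ : ℝ, 0 < γ₁ ∧ γ₁ ≤ 1 ∧
      ∀ η : ℝ, 0 < η → ∃ A : ℝ, ∀ (F : T3Family) (γ : ℝ), F.L = L → 0 < γ → γ ≤ γ₁ →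
        ∀ q : Plaq (F.P 0) 0, ∃ ρ : ℕ → ℝ,
          (∀ k K : ℕ, 1 ≤ k → ∑ j ∈ Finset.Ico k K, ρ j ≤ A + η * B10.pFun b₀ p₀ (Real.sqrt γ) ^ 2) ∧
          ∀ K : ℕ, 1 ≤ K →
            (gibbsK F ℰp γ (K + 1)).real {U | θBal F.L γ b₀ p₀ 0 ≤ GaugeGroup.dist1 (GaugeField.plaqHol
                (Averaging.iter (fun i => BlockAveraging.blockAvg (P := F.P (K + 1)) (j := i) ℰp) (K + 1) U)
                (plaqShift (F.sitesPerDir_unit (K + 1)) q))} ≤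
            Real.exp (ρ K) *
            (gibbsK F ℰp γ K).real {U | θBal F.L γ b₀ p₀ 0 ≤ GaugeGroup.dist1 (GaugeField.plaqHol
                (Averaging.iter (fun i => BlockAveraging.blockAvg (P := F.P K) (j := i) ℰp) K U)
                (plaqShift (F.sitesPerDir_unit K) q))}) :
    Summit.QuantumFields.YangMills.Theses.SmallFieldWidening.PlainStabAdd := by
  intro L b₀ p₀ hb₀ hp₀
  obtain ⟨γ₁, hγ₁, hγ₁1, hA⟩ := hPS L b₀ p₀ hb₀ hp₀
  obtain ⟨γb, C_b, c_b, N_b, hγb, hγb1, hc_b, hC_b, hbase⟩ := perPlaquette_boundedHeight_uniform 1 L b₀ p₀ hb₀ (by linarith)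
  obtain ⟨A, hA'⟩ := hA (c_b / 2) (half_pos hc_b)
  refine ⟨1, N_b, 0, min γ₁ γb, C_b, c_b, 0, c_b, c_b / 2, A, le_rfl, lt_min hγ₁ hγb, (min_le_left _ _).trans hγ₁1, hC_b, le_rfl,
    (half_pos hc_b).le, half_lt_self hc_b, half_lt_self hc_b, fun F γ hFL hγ hle q => ?_⟩
  obtain ⟨ρ, hρ, hstep⟩ := hA' F γ hFL hγ (hle.trans (min_le_left _ _)) q
  have hb := hbase F γ hFL hγ (hle.trans (min_le_right _ _)) 1 1 le_rfl le_rfl (plaqShift (F.sitesPerDir_unit 1) q)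
  simp only [Nat.sub_self, pow_zero, mul_one] at hb
  refine ⟨ρ, fun _ => 0, fun _ => 1, fun _ => ⟨by norm_num, le_rfl⟩, by simpa using hb, hρ, fun _ => le_rfl,
    fun K => by simp, fun K hK => by simpa using hstep K hK⟩

end Summit.QuantumFields.YangMills.Theorems.LargeFieldMassRefinementTailPlainStabAdd
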